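import Summits.ABC.ABC.Theorems.IsogenyGlueCongruenceEllipticGluingPrimeBoundStubCMIsotypicCoreOfAux2
import Summits.ABC.ABC.Theorems.IsogenyGlueCongruenceEllipticGluingPrimeBoundStubMinkowski
import Summits.ABC.ABC.Theorems.IsogenyGlueCongruenceEllipticGluingPrimeBoundStubRationalPartReduction
import HarnessLib

/-!
# Crux `EllipticGluingPrimeBound`, line Sketch — stub `stub_CMIsotypicCoreOf` (the CM isotypic core)

Stub `stub_CMIsotypicCoreOf` of line `Sketch` (isotypic–Minkowski reduction) of crux U
`Summit.ABC.ABC.Theses.IsogenyGlueCongruence.EllipticGluingPrimeBound` (stmt-ABC-13919); helpers in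
`…StubCMIsotypicCoreOfAux1` (the CM torsion fact makes the mod-`ℓ` image non-abelian) and
`…StubCMIsotypicCoreOfAux2` ((S_CM): irreducibility and scalar commutant of `W[ℓ]`).

**Statement.** Under two hypotheses — `hF2`, the CM torsion fact (registered neighbour
`stub_cmTorsionCartanImage`: the main theorem of complex multiplication read on `W[ℓ]`, i.e. `√D`,
the quadratic character twisting it, and the `12`-th powers of the Cartan `(O/ℓ)^×` in the image of
`Γ_K`), and `hK`, the CM torsion leaf (K†) (registered neighbour `stub_CMTorsionCoreOf`: a `ℚ`-free
geometrically `E`-isotypic `A/ℚ` carrying `W[ℓ] ↪ A(ℚ̄)` equivariantly at `ℓ > L₀` has a finite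
Galois image on a lattice of rank `≤ 4 dim A` of order divisible by `ℓ`, or `ℓ ≤ c (dim A + 1)²`) —
there are `L₀`, `c` such that for `W/ℚ` with CM, `E` its AV-model (`e : E(ℚ̄) ≃+ W(ℚ̄)`
equivariant), `B/ℚ` geometrically `E`-isotypic and `(E, B)` glued at a prime `ℓ > L₀` (a non-zero
multiplier exists, `ℓ` divides every multiplier): `ℓ ≤ c · (dim B)²`.

**Proof** (composition; `L₀ = max L_S L_K`, `c = 4 + max c_K 0`). (S_CM)
(`hasCM_irreducible_scalar_of_cmCartanImage hF2`, helpers 2/2) gives irreducibility and scalar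
commutant of `W[ℓ]` for `ℓ > L_S`; the LANDED rational-part reduction `stub_rationalPartReduction`
then yields a `ℚ`-free geometrically `E`-isotypic `A/ℚ`, `dim A + 1 ≤ dim B`, carrying `W[ℓ]`
equivariantly; `hK` on `A`: in its first disjunct the LANDED `stub_minkowski` (a prime dividing the
order of a finite subgroup of `GL_r(ℤ)` is `≤ r + 1`) gives `ℓ ≤ 4 dim A + 1 ≤ 4 dim B ≤ 4 (dim B)²`;
in its second, `ℓ ≤ c_K (dim A + 1)² ≤ max c_K 0 · (dim B)²`. The CM cyclotomic gluing family
(`y² = x³ − x`, `ℓ ≡ −1 (mod 4N)`, `dim B = 1 + 2φ(N)`) shows that the exponent `2` cannot be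
replaced by `1`. Everything is proved (axioms `propext`, `Classical.choice`, `Quot.sound`); no
`def`, no named fact (the two CM inputs are hypotheses, discharged by the neighbours).
-/

noncomputable section

-- `Summit.<Summit>.<Problem>` is the mandated summit-side namespace (CONVENTIONS §2); for the
-- single-conjunct summit `ABC` the two coincide, so the duplicate `ABC.ABC` is deliberate.
set_option linter.dupNamespace false

namespace Summit.ABC.ABC.Theorems.IsotypicMinkowski

open CategoryTheory CategoryTheory.Limits AlgebraicGeometry
open Literature.AlgebraicGeometry.Motives
open Summit.ABC.ABC.Theses.IsogenyGlueCongruence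

/-- **The CM isotypic core (K\*) from the CM torsion fact `hF2` and the torsion leaf `hK`.** For
`W/ℚ` with CM, `B` geometrically `E`-isotypic and `(E, B)` glued at a prime `ℓ > L₀`:
`ℓ ≤ c · (dim B)²`. Composition of (S_CM) (`hasCM_irreducible_scalar_of_cmCartanImage hF2`), the
landed rational-part reduction `stub_rationalPartReduction` (a `ℚ`-free geometrically isotypic
`A`, `dim A + 1 ≤ dim B`, carrying `W[ℓ]`), the leaf `hK` on `A`, and the landed `stub_minkowski` in
`hK`'s first disjunct (`ℓ ≤ 4 dim A + 1 ≤ 4 dim B`); `L₀ = max L_S L_K`, `c = 4 + max c_K 0`.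
[folklore] -/
theorem stub_CMIsotypicCoreOf
    (hF2 : ∃ L₀ : ℕ, ∀ (W : WeierstrassCurve ℚ) [W.IsElliptic], W.HasCM → ∀ ℓ : ℕ, ℓ.Prime → L₀ < ℓ →
      ∃ (φ : AddMonoid.End (W.geomTorsion ℓ)) (D : ℤ) (χ : Field.absoluteGaloisGroup ℚ →* ℤˣ),
        (∀ P : W.geomTorsion ℓ, φ (φ P) = D • P) ∧ ¬ (ℓ : ℤ) ∣ D ∧
        (∀ c : ℤ, ∃ P : W.geomTorsion ℓ, φ P ≠ c • P) ∧
        (∃ σ : Field.absoluteGaloisGroup ℚ, χ σ ≠ 1) ∧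
        (∀ (σ : Field.absoluteGaloisGroup ℚ) (P : W.geomTorsion ℓ),
          φ (σ • P) = ((χ σ : ℤˣ) : ℤ) • σ • φ P) ∧
        (∀ a b : ℤ, ¬ (ℓ : ℤ) ∣ a ^ 2 - D * b ^ 2 →
          ∃ σ : Field.absoluteGaloisGroup ℚ, χ σ = 1 ∧ ∀ P : W.geomTorsion ℓ,
            σ • P = (((a : AddMonoid.End (W.geomTorsion ℓ)) +
              (b : AddMonoid.End (W.geomTorsion ℓ)) * φ) ^ 12) P))
    (hK : ∃ (L₀ : ℕ) (c : ℝ), ∀ (W : WeierstrassCurve ℚ) [W.IsElliptic] (E A : AbelianVariety.{0} ℚ)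
      (e : E.geomPoints ≃+ W.geomPoints),
      (∀ (σ : Field.absoluteGaloisGroup ℚ) (P : E.geomPoints), e (σ • P) = σ • e P) →
      W.HasCM →
      (∀ (C : AbelianVariety.{0} (AlgebraicClosure ℚ))
          (g : A.baseChange (AlgebraicClosure ℚ) ⟶ C),
          Surjective (AbelianVariety.Hom.toSchemeHom g) → C.dim ≠ 0 →
          ∃ f : E.baseChange (AlgebraicClosure ℚ) ⟶ C, f ≠ 0) →
      (∀ f : E ⟶ A, f = 0) →
      ∀ ℓ : ℕ, ℓ.Prime → L₀ < ℓ →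
      (∃ ι : W.geomTorsion ℓ →+ A.geomPoints, Function.Injective ι ∧
        ∀ (σ : Field.absoluteGaloisGroup ℚ) (P : W.geomTorsion ℓ), ι (σ • P) = σ • ι P) →
        (∃ (r : ℕ) (G : Subgroup (Matrix.GeneralLinearGroup (Fin r) ℤ)),
          r ≤ 4 * A.dim ∧ Finite G ∧ ℓ ∣ Nat.card G) ∨
        (ℓ : ℝ) ≤ c * ((A.dim : ℝ) + 1) ^ 2) :
    ∃ (L₀ : ℕ) (c : ℝ), ∀ (W : WeierstrassCurve ℚ) [W.IsElliptic] (E B : AbelianVariety.{0} ℚ)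
      (e : E.geomPoints ≃+ W.geomPoints),
      (∀ (σ : Field.absoluteGaloisGroup ℚ) (P : E.geomPoints), e (σ • P) = σ • e P) →
      W.HasCM →
      (∀ (C : AbelianVariety.{0} (AlgebraicClosure ℚ))
          (g : B.baseChange (AlgebraicClosure ℚ) ⟶ C),
          Surjective (AbelianVariety.Hom.toSchemeHom g) → C.dim ≠ 0 →
          ∃ f : E.baseChange (AlgebraicClosure ℚ) ⟶ C, f ≠ 0) →
      ∀ ℓ : ℕ, ℓ.Prime → L₀ < ℓ →
      (∃ (α : E ⟶ B) (β : B ⟶ E) (n : ℤ), n ≠ 0 ∧ α ≫ β = n • 𝟙 E) →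
      (∀ (α : E ⟶ B) (β : B ⟶ E) (n : ℤ), α ≫ β = n • 𝟙 E → (ℓ : ℤ) ∣ n) →
        (ℓ : ℝ) ≤ c * (B.dim : ℝ) ^ 2 := by
  obtain ⟨L₁, hS⟩ := hasCM_irreducible_scalar_of_cmCartanImage hF2
  obtain ⟨L₂, c, hK⟩ := hK
  refine ⟨max L₁ L₂, 4 + max c 0, ?_⟩
  intro W _ E B e he hCM hiso ℓ hℓ hL hex hall
  have hL₁ : L₁ < ℓ := lt_of_le_of_lt (le_max_left _ _) hL
  have hL₂ : L₂ < ℓ := lt_of_le_of_lt (le_max_right _ _) hL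
  obtain ⟨hirr, hsc⟩ := hS W hCM ℓ hℓ hL₁
  -- the rational-part reduction: a `ℚ`-free geometrically isotypic `A`, `dim A + 1 ≤ dim B`
  obtain ⟨A, hA, hisoA, hfree, hι⟩ := stub_rationalPartReduction e he hiso hℓ hirr hsc hex hall
  have hA' : (A.dim : ℝ) + 1 ≤ B.dim := by exact_mod_cast hA
  have hA0 : (0 : ℝ) ≤ (A.dim : ℝ) + 1 := by positivity
  have hB1 : (1 : ℝ) ≤ B.dim := le_trans (by linarith [hA0]) hA'
  have hB2 : (B.dim : ℝ) ≤ (B.dim : ℝ) ^ 2 := by nlinarith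
  have hc0 : (0 : ℝ) ≤ max c 0 := le_max_right _ _
  -- the torsion leaf on `A`: Minkowski, or the quadratic bound
  rcases hK W E A e he hCM hisoA hfree ℓ hℓ hL₂ hι with ⟨r, G, hr, hG, hdvd⟩ | h1
  · haveI := hG
    have h2 := stub_minkowski r ℓ hℓ G hdvd
    have h3 : (ℓ : ℝ) ≤ 4 * (A.dim : ℝ) + 1 := by exact_mod_cast h2.trans (by omega)
    calc (ℓ : ℝ) ≤ 4 * (B.dim : ℝ) := by linarith
      _ ≤ 4 * (B.dim : ℝ) ^ 2 := by linarith
      _ ≤ (4 + max c 0) * (B.dim : ℝ) ^ 2 := by nlinarith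
  · calc (ℓ : ℝ) ≤ c * ((A.dim : ℝ) + 1) ^ 2 := h1
      _ ≤ max c 0 * ((A.dim : ℝ) + 1) ^ 2 :=
          mul_le_mul_of_nonneg_right (le_max_left _ _) (by positivity)
      _ ≤ max c 0 * (B.dim : ℝ) ^ 2 := mul_le_mul_of_nonneg_left (by gcongr) hc0
      _ ≤ (4 + max c 0) * (B.dim : ℝ) ^ 2 := by nlinarith

end Summit.ABC.ABC.Theorems.IsotypicMinkowski

end
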